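import Summits.NavierStokesRegularity.OSWSelfSimilar.SheetRResolventOddClass
import Summits.NavierStokesRegularity.OSWSelfSimilar.SheetRResolventEvenClass
import Literature.Analysis.OperatorTheory.PseudoResolventOperatorBasePoint
import HarnessLib

/-!
# SHEET-ℝ frame, Z3-SR-SPEC (P1)/(P5)⁺ reading: `generatorOdd` and `generatorEven` are ONE closed operator each —
# the base point `σ₀` of Kato's construction is immaterial

HONEST FRAMING (cell ns-blowup GROUP B / zone Z3, case Z3-SR-SPEC, both parities; 1-D MODEL certificate frame (viscous gCLM/OSW sheet on
the line); not Euler/NS; «violates: none — MODEL»).  selfsim g12/g14 defined Kato's closed operators `generatorOdd hL K h σ₀ hσ₀` (`T = −A_F|odd`)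
and `generatorEven hL K h σ₀ hσ₀` (`T⁺ = −A⁺_F|E⁺₀`) as `operatorOfResolvent (resolventOdd …) σ₀ _` / `operatorOfResolvent (resolventEven …) σ₀ _`
with a BASE POINT `σ₀` in the half-plane `{Re σ > −m}`; the defining resolvent relations hold for every `σ` there, so the operator «obviously»
does not depend on `σ₀`, but the tree only said so through the action (`generatorOdd_resolventOdd`, `mem_domain_iff`).  With the generic
`Literature.Analysis.OperatorTheory.IsPseudoResolvent.operatorOfResolvent_eq_of_mem` (Kato VIII-§1.1 p. 428: "`T` is a linear operator in `X`
with `D(T) = R`") this file records the sentence itself: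

* `generatorOdd_eq`, `generatorEven_eq`: for `σ₀, σ₁` in the half-plane the two `LinearPMap`s are EQUAL;
* `generatorOdd_exists_mem_domain_iff`, `generatorEven_exists_mem_domain_iff`: «`u ∈ D(T)` with `P (T u)`» is base-point free for every
  predicate `P` — the shape of the eigenvalue set-builders of `SheetRSpectrumEvenAssembly.eigen_set_eq_singleton` (base point `σ` itself) and of
  `SheetRLinearisedFlow` (base point of the semigroup generator), which may therefore be read with ONE fixed `T` / `T⁺`.

Hypotheses = the (S1)/(S1⁺) data `GardingDataKC` / `GardingDataKE` only (interval arithmetic of record elsewhere).  No definition, no named fact,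
no number.  WHAT THIS IS NOT: not NS; no spectral claim; bookkeeping of an operator-theoretic identity on a MODEL linearisation.
-/

noncomputable section

namespace Summit.NavierStokesRegularity.OSWSelfSimilar
namespace SheetRGeneratorBasePoint

open SheetREnergySpace SheetRComplexPivot SheetRPerturbedPair SheetRPerturbedResolventC SheetROddClass SheetRResolventOddClass
  SheetREvenEnergySpace SheetREvenForms SheetREvenClass SheetRResolventEvenClass Literature.Analysis.OperatorTheory

variable {L D₀ D₁ V₀ c m : ℝ} {d V : ℝ → ℝ}

/-! ### §1 Odd class -/

section Odd

variable (hL : 0 < L) (K : Esp L hL →L[ℝ] W L) (h : GardingDataKC L hL d V K D₀ D₁ V₀ c m)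

/-- **`generatorOdd` does not depend on the base point**: for `σ₀, σ₁` with `Re σᵢ > −m`,
`generatorOdd hL K h σ₀ _ = generatorOdd hL K h σ₁ _` (one closed operator `T = −A_F|odd`). [folklore] -/
theorem generatorOdd_eq {σ₀ σ₁ : ℂ} (hσ₀ : -m < σ₀.re) (hσ₁ : -m < σ₁.re) :
    generatorOdd hL K h σ₀ hσ₀ = generatorOdd hL K h σ₁ hσ₁ :=
  (isPseudoResolvent_resolventOdd hL K h).operatorOfResolvent_eq_of_mem hσ₀ hσ₁

/-- The domain `D(T)` does not depend on the base point. [folklore] -/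
theorem generatorOdd_domain_eq {σ₀ σ₁ : ℂ} (hσ₀ : -m < σ₀.re) (hσ₁ : -m < σ₁.re) :
    (generatorOdd hL K h σ₀ hσ₀).domain = (generatorOdd hL K h σ₁ hσ₁).domain :=
  (isPseudoResolvent_resolventOdd hL K h).operatorOfResolvent_domain_eq_of_mem hσ₀ hσ₁

/-- «`u ∈ D(T)` with `P (T u)`» does not depend on the base point, for every predicate `P` (eigen-equations with or without a rank-one
feedback, weak-image statements, …). [folklore] -/
theorem generatorOdd_exists_mem_domain_iff {σ₀ σ₁ : ℂ} (hσ₀ : -m < σ₀.re) (hσ₁ : -m < σ₁.re) (u : Wcodd L) (P : Wcodd L → Prop) :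
    (∃ hu : u ∈ (generatorOdd hL K h σ₀ hσ₀).domain, P (generatorOdd hL K h σ₀ hσ₀ ⟨u, hu⟩)) ↔
      ∃ hu : u ∈ (generatorOdd hL K h σ₁ hσ₁).domain, P (generatorOdd hL K h σ₁ hσ₁ ⟨u, hu⟩) :=
  (isPseudoResolvent_resolventOdd hL K h).exists_mem_domain_iff_of_mem hσ₀ hσ₁ u P

end Odd

/-! ### §2 Even zero-mass class -/

section Even

variable (hL : 0 < L) (K : EspE L hL →L[ℝ] W L) (h : GardingDataKE L hL d V K D₀ D₁ V₀ c m)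

/-- **`generatorEven` does not depend on the base point**: for `σ₀, σ₁` with `Re σᵢ > −m`,
`generatorEven hL K h σ₀ _ = generatorEven hL K h σ₁ _` (one closed operator `T⁺ = −A⁺_F|E⁺₀`). [folklore] -/
theorem generatorEven_eq {σ₀ σ₁ : ℂ} (hσ₀ : -m < σ₀.re) (hσ₁ : -m < σ₁.re) :
    generatorEven hL K h σ₀ hσ₀ = generatorEven hL K h σ₁ hσ₁ :=
  (isPseudoResolvent_resolventEven hL K h).operatorOfResolvent_eq_of_mem hσ₀ hσ₁

/-- The domain `D(T⁺)` does not depend on the base point. [folklore] -/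
theorem generatorEven_domain_eq {σ₀ σ₁ : ℂ} (hσ₀ : -m < σ₀.re) (hσ₁ : -m < σ₁.re) :
    (generatorEven hL K h σ₀ hσ₀).domain = (generatorEven hL K h σ₁ hσ₁).domain :=
  (isPseudoResolvent_resolventEven hL K h).operatorOfResolvent_domain_eq_of_mem hσ₀ hσ₁

/-- «`u ∈ D(T⁺)` with `P (T⁺ u)`» does not depend on the base point, for every predicate `P` — e.g. the eigen-equation
`T⁺u = σu − θ⟪h⁺,u⟫h⁺` of `SheetRSpectrumEvenAssembly.eigen_set_eq_singleton`, written there with base point `σ`. [folklore] -/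
theorem generatorEven_exists_mem_domain_iff {σ₀ σ₁ : ℂ} (hσ₀ : -m < σ₀.re) (hσ₁ : -m < σ₁.re) (u : WcevenZ hL) (P : WcevenZ hL → Prop) :
    (∃ hu : u ∈ (generatorEven hL K h σ₀ hσ₀).domain, P (generatorEven hL K h σ₀ hσ₀ ⟨u, hu⟩)) ↔
      ∃ hu : u ∈ (generatorEven hL K h σ₁ hσ₁).domain, P (generatorEven hL K h σ₁ hσ₁ ⟨u, hu⟩) :=
  (isPseudoResolvent_resolventEven hL K h).exists_mem_domain_iff_of_mem hσ₀ hσ₁ u P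

end Even

end SheetRGeneratorBasePoint
end Summit.NavierStokesRegularity.OSWSelfSimilar

end
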